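import Summits.Langlands.Langlands.Theorems.PhantomRMYoshidaResiduallyYoshidaLiftingSplitFrame
import Mathlib.NumberTheory.Padics.Complex
import Mathlib.RingTheory.Ideal.Quotient.Basic
import Mathlib.Topology.Algebra.Ring.Basic
import Mathlib.FieldTheory.IntermediateField.Adjoin.Basic
import HarnessLib

/-!
# Ribet's non-split lattice over `ℤ̄_p` — I. Congruences, balls and finite nets

Lead prover-line-stmt-Langlands-13639-c2-0 (line `sector-klingen-split`, crux `ResiduallyYoshidaLifting`,
stmt-Langlands-13639), toward the registered stub `stub_ribetNonsplitLattice` (census §7 R1(a)).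

We work over `K = ℚ̄_p = PadicAlgCl p` with its spectral norm and `𝒪 = 𝒪_K = Valued.integer K` (a NON-discrete
rank-one valuation ring), residue map `res : 𝒪 → κ`.  This file collects the elementary tools of the direct proof
of Ribet's lemma over `𝒪`:

* `ballIdeal δ` — for `0 < δ` the open ball `{x ∈ 𝒪 | ‖x‖ < δ}` is an IDEAL of `𝒪` (ultrametric inequality);
  for `δ ≤ 1` it lies in the maximal ideal, so congruence modulo `ballIdeal δ` refines congruence modulo `𝔪`.
* `exists_eq_mul_of_norm_le` — divisibility in `𝒪` is decided by norms.
* `defect M W = M₁₂ + M₁₁ W - W M₂₂ - W M₂₁ W` — the "defect of invariance" of the graph of `W : n → m` under a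
  block matrix `M`; it commutes with ring homomorphisms (`defect_map`), hence with every reduction map.
* `exists_finset_net` — a continuous `ρ : Γ → GL(𝒪)` on a COMPACT group is, modulo `ballIdeal δ`, equal to one
  of finitely many of its values (finite image of `ρ mod δ`).
* `IsRat E M` — a matrix over `𝒪` is `E`-RATIONAL for an intermediate field `ℚ_p ⊆ E ⊆ ℚ̄_p` when its entries
  lie in `E`; closure under the ring operations, and the RESIDUE SUBFIELD `residueSubfield E ⊆ κ` of `E`
  (residues of `E`-rational integers) with its lifting property `exists_isRat_lift`.

References: K. Ribet, *A modular construction of unramified p-extensions of ℚ(μ_p)*, Invent. Math. 34 (1976),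
Prop. 2.1; J. Bellaïche, G. Chenevier, *Families of Galois representations and Selmer groups*, Astérisque 324
(2009), §1.5 (the case of a discrete valuation ring / a noetherian base).  The non-discrete case treated in this
series of files is not in these sources; see file III for the argument.
-/

noncomputable section

open scoped MatrixGroups

open Matrix IsLocalRing

-- `Summit.Langlands.Langlands.…` (summit = sub-problem name, D-0017 layout) trips `dupNamespace` on every decl.
set_option linter.dupNamespace false
set_option autoImplicit false

namespace Summit.Langlands.Langlands.Cruxes.ResiduallyYoshidaLifting.SectorKlingenSplit.Ribet

open Summit.Langlands.Langlands.Cruxes.ResiduallyYoshidaLifting.EndoscopicCrossingEuler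

variable {p : ℕ} [Fact p.Prime]

/-! ### Balls are ideals -/

/-- The open ball `{x ∈ 𝒪_{ℚ̄_p} | ‖x‖ < δ}` (`0 < δ`), an ideal of the valuation ring by the ultrametric
inequality. [folklore] -/
def ballIdeal (δ : ℝ) (hδ : 0 < δ) : Ideal (Valued.integer (PadicAlgCl p)) where
  carrier := {x | ‖(x : PadicAlgCl p)‖ < δ}
  add_mem' {x y} hx hy := by
    simp only [Set.mem_setOf_eq] at hx hy ⊢
    push_cast
    exact lt_of_le_of_lt (IsUltrametricDist.norm_add_le_max _ _) (max_lt hx hy)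
  zero_mem' := by simpa using hδ
  smul_mem' c {x} hx := by
    simp only [Set.mem_setOf_eq, smul_eq_mul] at hx ⊢
    push_cast
    rw [norm_mul]
    exact lt_of_le_of_lt (mul_le_of_le_one_left (norm_nonneg _)
      ((mem_integer_iff_norm_le_one _).1 c.2)) hx

/-- Membership in `ballIdeal δ`. [folklore] -/
@[simp] theorem mem_ballIdeal {δ : ℝ} (hδ : 0 < δ) (x : Valued.integer (PadicAlgCl p)) :
    x ∈ ballIdeal δ hδ ↔ ‖(x : PadicAlgCl p)‖ < δ := Iff.rfl

/-- For `δ ≤ 1` the ball ideal lies in the maximal ideal `{‖x‖ < 1}`. [folklore] -/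
theorem ballIdeal_le_maximalIdeal {δ : ℝ} (hδ : 0 < δ) (hδ1 : δ ≤ 1) :
    ballIdeal (p := p) δ hδ ≤ maximalIdeal (Valued.integer (PadicAlgCl p)) := by
  intro x hx
  rw [mem_maximalIdeal_integer_iff]
  exact lt_of_lt_of_le hx hδ1

/-- Congruence modulo `ballIdeal δ`, `δ ≤ 1`, implies equal residues. [folklore] -/
theorem residue_eq_of_mk_ballIdeal_eq {δ : ℝ} (hδ : 0 < δ) (hδ1 : δ ≤ 1)
    {x y : Valued.integer (PadicAlgCl p)}
    (h : Ideal.Quotient.mk (ballIdeal δ hδ) x = Ideal.Quotient.mk (ballIdeal δ hδ) y) :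
    residue (Valued.integer (PadicAlgCl p)) x = residue (Valued.integer (PadicAlgCl p)) y := by
  rw [Ideal.Quotient.eq] at h
  exact (Ideal.Quotient.eq).2 (ballIdeal_le_maximalIdeal hδ hδ1 h)

/-- Matrix form of `residue_eq_of_mk_ballIdeal_eq`. [folklore] -/
theorem map_residue_eq_of_map_mk_eq {δ : ℝ} (hδ : 0 < δ) (hδ1 : δ ≤ 1) {m n : Type*}
    {M N : Matrix m n (Valued.integer (PadicAlgCl p))}
    (h : M.map (Ideal.Quotient.mk (ballIdeal δ hδ)) = N.map (Ideal.Quotient.mk (ballIdeal δ hδ))) :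
    M.map (residue (Valued.integer (PadicAlgCl p))) = N.map (residue (Valued.integer (PadicAlgCl p))) := by
  ext i j
  exact residue_eq_of_mk_ballIdeal_eq hδ hδ1 (congrFun (congrFun h i) j)

/-- Two integers congruent modulo `ballIdeal δ` are `δ`-close. [folklore] -/
theorem norm_sub_lt_of_mk_eq {δ : ℝ} (hδ : 0 < δ) {x y : Valued.integer (PadicAlgCl p)}
    (h : Ideal.Quotient.mk (ballIdeal δ hδ) x = Ideal.Quotient.mk (ballIdeal δ hδ) y) :
    ‖(x : PadicAlgCl p) - y‖ < δ := by
  rw [Ideal.Quotient.eq, mem_ballIdeal] at h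
  simpa using h

/-- `δ`-close integers are congruent modulo `ballIdeal δ`. [folklore] -/
theorem mk_eq_of_norm_sub_lt {δ : ℝ} (hδ : 0 < δ) {x y : Valued.integer (PadicAlgCl p)}
    (h : ‖(x : PadicAlgCl p) - y‖ < δ) :
    Ideal.Quotient.mk (ballIdeal δ hδ) x = Ideal.Quotient.mk (ballIdeal δ hδ) y := by
  rw [Ideal.Quotient.eq, mem_ballIdeal]
  simpa using h

/-! ### Norms and divisibility in `𝒪` -/

/-- Divisibility in the valuation ring is decided by norms: `‖x‖ ≤ ‖t‖`, `t ≠ 0` gives `x = t·y`.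
[folklore] -/
theorem exists_eq_mul_of_norm_le {x t : Valued.integer (PadicAlgCl p)} (ht : t ≠ 0)
    (h : ‖(x : PadicAlgCl p)‖ ≤ ‖(t : PadicAlgCl p)‖) :
    ∃ y : Valued.integer (PadicAlgCl p), x = t * y := by
  have ht' : (t : PadicAlgCl p) ≠ 0 := fun h0 => ht (Subtype.ext h0)
  have hy : (x : PadicAlgCl p) / t ∈ Valued.integer (PadicAlgCl p) := by
    rw [mem_integer_iff_norm_le_one, norm_div]
    exact div_le_one_of_le₀ h (norm_nonneg _)
  refine ⟨⟨_, hy⟩, Subtype.ext ?_⟩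
  push_cast
  rw [mul_div_cancel₀ _ ht']

/-- Matrix form of `exists_eq_mul_of_norm_le`. [folklore] -/
theorem exists_eq_smul_of_norm_le {m n : Type*} {M : Matrix m n (Valued.integer (PadicAlgCl p))}
    {t : Valued.integer (PadicAlgCl p)} (ht : t ≠ 0)
    (h : ∀ i j, ‖(M i j : PadicAlgCl p)‖ ≤ ‖(t : PadicAlgCl p)‖) :
    ∃ N : Matrix m n (Valued.integer (PadicAlgCl p)), M = t • N := by
  choose f hf using fun i j => exists_eq_mul_of_norm_le ht (h i j)
  exact ⟨Matrix.of f, Matrix.ext fun i j => by simpa using hf i j⟩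

/-- `t • y` has norm `< ‖t‖` as soon as `res y = 0` and `t ≠ 0`. [folklore] -/
theorem norm_mul_lt_of_residue_eq_zero {t y : Valued.integer (PadicAlgCl p)} (ht : t ≠ 0)
    (hy : residue (Valued.integer (PadicAlgCl p)) y = 0) :
    ‖((t * y : Valued.integer (PadicAlgCl p)) : PadicAlgCl p)‖ < ‖(t : PadicAlgCl p)‖ := by
  have ht' : (t : PadicAlgCl p) ≠ 0 := fun h0 => ht (Subtype.ext h0)
  rw [residue_eq_zero_iff_norm_lt_one] at hy
  push_cast
  rw [norm_mul]
  exact mul_lt_of_lt_one_right (norm_pos_iff.2 ht') hy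

/-! ### The defect of a graph and its functoriality -/

/-- The DEFECT of invariance of the graph `{(W y, y)}` of `W : n → m` under the block matrix `M`:
`M₁₂ + M₁₁ W - W M₂₂ - W M₂₁ W`.  It vanishes iff the graph is `M`-stable. [folklore] -/
def defect {R : Type*} [CommRing R] {m n : Type*} [Fintype m] [Fintype n]
    (M : Matrix (m ⊕ n) (m ⊕ n) R) (W : Matrix m n R) : Matrix m n R :=
  M.toBlocks₁₂ + M.toBlocks₁₁ * W - W * M.toBlocks₂₂ - W * M.toBlocks₂₁ * W

/-- Blocks commute with entrywise maps. [folklore] -/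
theorem toBlocks₁₁_map {R S : Type*} {m n : Type*} (M : Matrix (m ⊕ n) (m ⊕ n) R) (f : R → S) :
    (M.map f).toBlocks₁₁ = M.toBlocks₁₁.map f := rfl

/-- Blocks commute with entrywise maps. [folklore] -/
theorem toBlocks₁₂_map {R S : Type*} {m n : Type*} (M : Matrix (m ⊕ n) (m ⊕ n) R) (f : R → S) :
    (M.map f).toBlocks₁₂ = M.toBlocks₁₂.map f := rfl

/-- Blocks commute with entrywise maps. [folklore] -/
theorem toBlocks₂₁_map {R S : Type*} {m n : Type*} (M : Matrix (m ⊕ n) (m ⊕ n) R) (f : R → S) :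
    (M.map f).toBlocks₂₁ = M.toBlocks₂₁.map f := rfl

/-- Blocks commute with entrywise maps. [folklore] -/
theorem toBlocks₂₂_map {R S : Type*} {m n : Type*} (M : Matrix (m ⊕ n) (m ⊕ n) R) (f : R → S) :
    (M.map f).toBlocks₂₂ = M.toBlocks₂₂.map f := rfl

/-- The defect commutes with ring homomorphisms. [folklore] -/
theorem defect_map {R S : Type*} [CommRing R] [CommRing S] {m n : Type*} [Fintype m] [Fintype n]
    (f : R →+* S) (M : Matrix (m ⊕ n) (m ⊕ n) R) (W : Matrix m n R) :
    (defect M W).map f = defect (M.map f) (W.map f) := by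
  simp only [defect, toBlocks₁₁_map, toBlocks₁₂_map, toBlocks₂₁_map, toBlocks₂₂_map]
  rw [Matrix.map_sub _ (map_sub f), Matrix.map_sub _ (map_sub f), Matrix.map_add _ (map_add f),
    Matrix.map_mul, Matrix.map_mul, Matrix.map_mul, Matrix.map_mul]

/-! ### Finite nets on a compact group -/

/-- On a COMPACT group, a homomorphism `ρ : Γ → GL(𝒪)` with continuous entries is congruent modulo
`ballIdeal δ` to one of FINITELY many of its values: the open sets `{g | ρ g ≡ ρ γ}` cover `Γ`. [folklore] -/
theorem exists_finset_net {Γ : Type*} [Group Γ] [TopologicalSpace Γ] [CompactSpace Γ] {ι : Type*}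
    [Fintype ι] [DecidableEq ι] (ρ : Γ →* GL ι (Valued.integer (PadicAlgCl p)))
    (hρ : ∀ i j, Continuous fun g => (((ρ g : GL ι (Valued.integer (PadicAlgCl p))) :
      Matrix ι ι (Valued.integer (PadicAlgCl p))) i j : PadicAlgCl p))
    {δ : ℝ} (hδ : 0 < δ) :
    ∃ F : Finset Γ, ∀ g, ∃ γ ∈ F,
      ((ρ g : GL ι (Valued.integer (PadicAlgCl p))) : Matrix ι ι (Valued.integer (PadicAlgCl p))).map
          (Ideal.Quotient.mk (ballIdeal δ hδ)) =
        ((ρ γ : GL ι (Valued.integer (PadicAlgCl p))) : Matrix ι ι (Valued.integer (PadicAlgCl p))).map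
          (Ideal.Quotient.mk (ballIdeal δ hδ)) := by
  classical
  let U : Γ → Set Γ := fun γ => {g | ∀ i j,
    ‖((((ρ g : GL ι (Valued.integer (PadicAlgCl p))) : Matrix ι ι (Valued.integer (PadicAlgCl p))) i j :
        PadicAlgCl p)) -
      (((ρ γ : GL ι (Valued.integer (PadicAlgCl p))) : Matrix ι ι (Valued.integer (PadicAlgCl p))) i j :
        PadicAlgCl p)‖ < δ}
  have hU : ∀ γ, IsOpen (U γ) := by
    intro γ
    simp only [U, Set.setOf_forall]
    refine isOpen_iInter_of_finite fun i => isOpen_iInter_of_finite fun j => ?_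
    exact isOpen_lt ((hρ i j).sub continuous_const).norm continuous_const
  have hcover : (Set.univ : Set Γ) ⊆ ⋃ γ, U γ := by
    intro g _
    exact Set.mem_iUnion.2 ⟨g, fun i j => by simpa using hδ⟩
  obtain ⟨F, hF⟩ := isCompact_univ.elim_finite_subcover U hU hcover
  refine ⟨F, fun g => ?_⟩
  obtain ⟨γ, hγF, hγ⟩ : ∃ γ ∈ F, g ∈ U γ := by
    simpa [Set.mem_iUnion] using hF (Set.mem_univ g)
  refine ⟨γ, hγF, Matrix.ext fun i j => ?_⟩
  exact mk_eq_of_norm_sub_lt hδ (hγ i j)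

/-! ### `E`-rational integral matrices and the residue subfield of `E` -/

section Rational

variable {p : ℕ} [Fact p.Prime] (E : IntermediateField ℚ_[p] (PadicAlgCl p))

/-- An integral matrix is `E`-rational when all its entries lie in the intermediate field `E`. [folklore] -/
def IsRat {m n : Type*} (M : Matrix m n (Valued.integer (PadicAlgCl p))) : Prop :=
  ∀ i j, ((M i j : Valued.integer (PadicAlgCl p)) : PadicAlgCl p) ∈ E

variable {E}

/-- `0` is rational. [folklore] -/
theorem isRat_zero {m n : Type*} : IsRat E (0 : Matrix m n (Valued.integer (PadicAlgCl p))) :=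
  fun _ _ => by simp

/-- Sums of rational matrices are rational. [folklore] -/
theorem IsRat.add {m n : Type*} {M N : Matrix m n (Valued.integer (PadicAlgCl p))} (hM : IsRat E M)
    (hN : IsRat E N) : IsRat E (M + N) := fun i j => by
  simpa using E.add_mem (hM i j) (hN i j)

/-- Differences of rational matrices are rational. [folklore] -/
theorem IsRat.sub {m n : Type*} {M N : Matrix m n (Valued.integer (PadicAlgCl p))} (hM : IsRat E M)
    (hN : IsRat E N) : IsRat E (M - N) := fun i j => by
  simpa using E.sub_mem (hM i j) (hN i j)

/-- Products of rational matrices are rational. [folklore] -/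
theorem IsRat.mul {l m n : Type*} [Fintype m] {M : Matrix l m (Valued.integer (PadicAlgCl p))}
    {N : Matrix m n (Valued.integer (PadicAlgCl p))} (hM : IsRat E M) (hN : IsRat E N) :
    IsRat E (M * N) := fun i j => by
  simp only [Matrix.mul_apply]
  push_cast
  exact E.sum_mem fun k _ => E.mul_mem (hM i k) (hN k j)

/-- Rational scalar multiples of rational matrices are rational. [folklore] -/
theorem IsRat.smul {m n : Type*} {M : Matrix m n (Valued.integer (PadicAlgCl p))}
    {t : Valued.integer (PadicAlgCl p)} (ht : (t : PadicAlgCl p) ∈ E) (hM : IsRat E M) :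
    IsRat E (t • M) := fun i j => by
  rw [Matrix.smul_apply, smul_eq_mul]
  push_cast
  exact E.mul_mem ht (hM i j)

/-- Blocks of a rational matrix are rational. [folklore] -/
theorem IsRat.toBlocks {m n : Type*} {M : Matrix (m ⊕ n) (m ⊕ n) (Valued.integer (PadicAlgCl p))}
    (hM : IsRat E M) :
    IsRat E M.toBlocks₁₁ ∧ IsRat E M.toBlocks₁₂ ∧ IsRat E M.toBlocks₂₁ ∧ IsRat E M.toBlocks₂₂ :=
  ⟨fun _ _ => hM _ _, fun _ _ => hM _ _, fun _ _ => hM _ _, fun _ _ => hM _ _⟩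

/-- If `t • N` is rational and `t ∈ E` is non-zero then `N` is rational. [folklore] -/
theorem IsRat.of_smul {m n : Type*} {N : Matrix m n (Valued.integer (PadicAlgCl p))}
    {t : Valued.integer (PadicAlgCl p)} (ht : (t : PadicAlgCl p) ∈ E) (ht0 : t ≠ 0)
    (h : IsRat E (t • N)) : IsRat E N := fun i j => by
  have ht' : (t : PadicAlgCl p) ≠ 0 := fun h0 => ht0 (Subtype.ext h0)
  have h1 := h i j
  simp only [Matrix.smul_apply, smul_eq_mul] at h1
  push_cast at h1
  have : ((N i j : Valued.integer (PadicAlgCl p)) : PadicAlgCl p) = (t : PadicAlgCl p)⁻¹ * (t * N i j) := by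
    rw [← mul_assoc, inv_mul_cancel₀ ht', one_mul]
  rw [this]
  exact E.mul_mem (E.inv_mem ht) h1

variable (E) in
/-- The RESIDUE SUBFIELD of `E`: residues of `E`-rational elements of `𝒪`.  It is a subfield of `κ` because an
`E`-rational unit of `𝒪` has an `E`-rational inverse. [folklore] -/
def residueSubfield : Subfield (ResidueField (Valued.integer (PadicAlgCl p))) where
  carrier := {x | ∃ y : Valued.integer (PadicAlgCl p), (y : PadicAlgCl p) ∈ E ∧
    residue (Valued.integer (PadicAlgCl p)) y = x}
  mul_mem' := by
    rintro _ _ ⟨y, hy, rfl⟩ ⟨z, hz, rfl⟩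
    exact ⟨y * z, by push_cast; exact E.mul_mem hy hz, by simp⟩
  one_mem' := ⟨1, by simp, by simp⟩
  add_mem' := by
    rintro _ _ ⟨y, hy, rfl⟩ ⟨z, hz, rfl⟩
    exact ⟨y + z, by push_cast; exact E.add_mem hy hz, by simp⟩
  zero_mem' := ⟨0, by simp, by simp⟩
  neg_mem' := by
    rintro _ ⟨y, hy, rfl⟩
    exact ⟨-y, by push_cast; exact E.neg_mem hy, by simp⟩
  inv_mem' := by
    rintro _ ⟨y, hy, rfl⟩
    by_cases h0 : residue (Valued.integer (PadicAlgCl p)) y = 0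
    · exact ⟨0, by simp, by simp [h0]⟩
    · have hu : IsUnit y := (IsLocalRing.residue_ne_zero_iff_isUnit y).1 h0
      obtain ⟨u, rfl⟩ := hu
      refine ⟨((u⁻¹ : (Valued.integer (PadicAlgCl p))ˣ) : Valued.integer (PadicAlgCl p)), ?_, ?_⟩
      · have h1 : (((u⁻¹ : (Valued.integer (PadicAlgCl p))ˣ) : Valued.integer (PadicAlgCl p)) :
            PadicAlgCl p) = ((u : Valued.integer (PadicAlgCl p)) : PadicAlgCl p)⁻¹ := by
          refine eq_inv_of_mul_eq_one_left ?_
          exact_mod_cast u.inv_mul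
        rw [h1]
        exact E.inv_mem hy
      · rw [map_units_inv]

/-- Membership in the residue subfield. [folklore] -/
theorem mem_residueSubfield {x : ResidueField (Valued.integer (PadicAlgCl p))} :
    x ∈ residueSubfield E ↔ ∃ y : Valued.integer (PadicAlgCl p), (y : PadicAlgCl p) ∈ E ∧
      residue (Valued.integer (PadicAlgCl p)) y = x := Iff.rfl

/-- Residues of the entries of a rational matrix lie in the residue subfield. [folklore] -/
theorem IsRat.residue_mem {m n : Type*} {M : Matrix m n (Valued.integer (PadicAlgCl p))} (hM : IsRat E M)
    (i : m) (j : n) : residue (Valued.integer (PadicAlgCl p)) (M i j) ∈ residueSubfield E :=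
  ⟨M i j, hM i j, rfl⟩

/-- A matrix with entries in the residue subfield lifts to a rational integral matrix. [folklore] -/
theorem exists_isRat_lift {m n : Type*} (X₁ : Matrix m n (ResidueField (Valued.integer (PadicAlgCl p))))
    (hX₁ : ∀ a c, X₁ a c ∈ residueSubfield E) :
    ∃ X : Matrix m n (Valued.integer (PadicAlgCl p)), IsRat E X ∧
      X.map (residue (Valued.integer (PadicAlgCl p))) = X₁ := by
  have h : ∀ a c, ∃ y : Valued.integer (PadicAlgCl p), (y : PadicAlgCl p) ∈ E ∧
      residue (Valued.integer (PadicAlgCl p)) y = X₁ a c := hX₁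
  choose f hf hres using h
  exact ⟨Matrix.of f, fun a c => hf a c, Matrix.ext fun a c => hres a c⟩

end Rational

/-- **Registered statement `stub_ribetFiniteNet`** (wrapper of `exists_finset_net` in metric form, the form
recorded on the crux item): a `GL(𝒪)`-valued homomorphism with continuous entries on a compact group is
uniformly `δ`-close to finitely many of its values. [folklore] -/
theorem stub_ribetFiniteNet :
    ∀ (p : ℕ) [Fact p.Prime] (Γ : Type) [Group Γ] [TopologicalSpace Γ] [CompactSpace Γ] (ι : Type)
      [Fintype ι] [DecidableEq ι] (ρ : Γ →* GL ι (Valued.integer (PadicAlgCl p))),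
      (∀ i j, Continuous fun g => (((ρ g : GL ι (Valued.integer (PadicAlgCl p))) :
        Matrix ι ι (Valued.integer (PadicAlgCl p))) i j : PadicAlgCl p)) →
      ∀ δ : ℝ, 0 < δ → ∃ F : Finset Γ, ∀ g, ∃ γ ∈ F, ∀ i j,
        ‖((((ρ g : GL ι (Valued.integer (PadicAlgCl p))) : Matrix ι ι (Valued.integer (PadicAlgCl p))) i j :
            PadicAlgCl p)) -
          (((ρ γ : GL ι (Valued.integer (PadicAlgCl p))) : Matrix ι ι (Valued.integer (PadicAlgCl p))) i j :
            PadicAlgCl p)‖ < δ := by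
  intro p _ Γ _ _ _ ι _ _ ρ hρ δ hδ
  obtain ⟨F, hF⟩ := exists_finset_net ρ hρ hδ
  refine ⟨F, fun g => ?_⟩
  obtain ⟨γ, hγ, h⟩ := hF g
  exact ⟨γ, hγ, fun i j => norm_sub_lt_of_mk_eq hδ (congrFun (congrFun h i) j)⟩

end Summit.Langlands.Langlands.Cruxes.ResiduallyYoshidaLifting.SectorKlingenSplit.Ribet

end
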